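import Literature.Probability.Percolation.GladkovZiminThreeCopy
import Literature.Probability.Percolation.GladkovZiminKernelMeasure
import HarnessLib

/-!
# The three-copy Gladkov–Zimin kernel inequality for bond percolation laws (`prodBernoulli`)

Topic `Literature/Probability/Percolation`.  Transfer of the finitary three-copy kernel inequality
`DecisionTree.kernel3_classMass_le` (`GladkovZiminThreeCopy.lean`: Gladkov–Zimin, *On Harris–Kleitman type
inequalities*, draft 2024, §5 Thm. 5.1, case `k = 3` [GladkovZimin2024HK]) to the bond-percolation measure
`prodBernoulli w`, exactly as `GladkovZiminKernelMeasure.lean` does for the two-copy inequality: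

* **`prodBernoulli_kernel3_labelClass_le`** — for every labelling `lab` of configurations by a preorder,
  monotone under adding open edges, every finite `t` containing all labels, and every triple-supermodular
  kernel `B` (`DecisionTree.TripleSuper (Sym2 V) B`, e.g. by `tripleSuper_of_pointwise`):
  `Σ_{a,b,c ∈ t} B a b c · μ(lab = a) μ(lab = b) μ(lab = c) ≤ Σ_{a ∈ t} B a a a · μ(lab = a)`.

This is the row lemma for the cubic "three-copy GZ rows" of the percolation certificate searches of
`Summits/CriticalPhenomena/PercolationContinuityZ3` (crux `NoHeavyLowerTail`; memo
run/shared/lean/prim/prim-ineq-gen-2/COPOSITIVE-GZ.md): `lab ω` = partition of the marked terminals into open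
clusters, `B` a symmetric 3-tensor on the partition lattice satisfying the two endpoint inequalities.

## References
* N. Gladkov, A. Zimin, *On Harris–Kleitman type inequalities*, unpublished draft, September 2024, Thm. 2.3, §5
  Thm. 5.1. [GladkovZimin2024HK]
-/

noncomputable section

namespace Literature.Probability.Percolation

open MeasureTheory Literature.Probability.LatticeModels DecisionTree
open scoped Classical

/-- **Three-copy Gladkov–Zimin kernel inequality for `prodBernoulli`.**  Let `lab` label bond configurations
of a finite vertex type by a preorder, monotonically under adding open edges, let `t` contain every value of
`lab`, and let `B` be triple-supermodular along the cube of edges (`TripleSuper (Sym2 V) B`).  Then, with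
`μ = prodBernoulli w`, `Σ_{a,b,c ∈ t} B a b c · μ(lab = a) μ(lab = b) μ(lab = c) ≤ Σ_{a ∈ t} B a a a · μ(lab = a)`.
[cite: GladkovZimin2024HK, §5, Thm. 5.1 (k = 3)] -/
theorem prodBernoulli_kernel3_labelClass_le {V : Type*} [Fintype V]
    (w : Sym2 V → unitInterval) {κ : Type*} [Preorder κ] (lab : BondConfig V → κ)
    (hlab : ∀ ⦃ω ω' : BondConfig V⦄, ω ⊆ ω' → lab ω ≤ lab ω') (t : Finset κ) (ht : ∀ ω, lab ω ∈ t)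
    (B : κ → κ → κ → ℝ) (hB : TripleSuper (Sym2 V) B) :
    ∑ a ∈ t, ∑ b ∈ t, ∑ c ∈ t, B a b c *
        ((prodBernoulli w).real {ω | lab ω = a} * (prodBernoulli w).real {ω | lab ω = b} *
          (prodBernoulli w).real {ω | lab ω = c}) ≤
      ∑ a ∈ t, B a a a * (prodBernoulli w).real {ω | lab ω = a} := by
  simp only [prodBernoulli_real_labelClass_eq_classMass]
  exact kernel3_classMass_le Finset.univ (fun e => (w e).2.1) (fun e => (w e).2.2)
    (fun S : Finset (Sym2 V) => lab ↑S) (fun S T hST => hlab (Finset.coe_subset.2 hST)) t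
    (fun S _ => ht _) B hB

end Literature.Probability.Percolation

end
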